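import Mathlib
import Literature.NumberTheory.LFunctions.Zhang2022.Section15CEq1522Edge
import Literature.NumberTheory.LFunctions.Zhang2022.Section15CEq1521Wide
import HarnessLib

/-!
# Zhang (2022) §15 p. 87, (15.22): the deduction with (15.19), (15.20), (15.21) DISCHARGED —
# leaf `h15_22` reduced to the Rankin cut, Lemma 15.1 (χ-reading) and the smooth majorant

Topic `Literature/NumberTheory/LFunctions/Zhang2022` (Landau–Siegel audit tree; verdict-neutral).
Y. Zhang, *Discrete mean estimates and the Landau–Siegel zero*, arXiv:2211.02515v1 (2022)
[Zhang2022LandauSiegel] — **an unrefereed manuscript under adjudication; nothing in this file asserts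
any claim of the manuscript or anything about its Theorems 1–2.** ZHANG-L discharge lane (WP15), leaf
`h15_22 : Typed.Section15C.Eq15_22 c′ Typed.Section15C.inputs15ABchi`; DAG node `Z22:(15.22)`
[Z22 §15 p. 87, tex L4306–L4307].

The tree edge `Typed.Section15C.eq15_22_chi_of_parts` (`Section15CEq1522Edge`) takes the typed (15.18)
`Typed.Section15B.Eq15_18 c′` as a hypothesis; as typed, (15.18) divides by `𝓜₁(1,1;s)` on the whole
half-plane `σ > 9/10` and so also asserts its non-vanishing there — more than the chain uses and not
what the lane discharges (zl-w15-p4's `Section15CalM1Ratio` proves (15.18) OFF the zero set and, from it,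
the nodes (15.19)/(15.20) outright: `Typed.Section15B.eq15_19_chi_holds`, `eq15_20_chi_holds`). This file
re-runs the same bookkeeping from (15.19) + (15.20) directly AND generically in the value of Lemma 15.1
(`calS1_eval_of_parts_value`, arbitrary value family `V j`; RT-05 / R-28: closers born generic in e″, proof
identical to the edge's) and plugs the discharged inputs:

* `calS1_eval_of_parts` — the WP15-PLAN Sketch shape (value `(E1 j + ι₂e₂ⱼ)(ῑ₃e₃ⱼ + ῑ₄e₂ⱼ)`, any
  `E1 : ℕ → ℂ`): `Inline15_Rankin c′ bChi → [Lemma 15.1 at E1] → [smooth majorant ≪ 𝓛⁶] → (15.22) at E1`,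
  with (15.19), (15.20) (`eq15_19_chi_holds`, `eq15_20_chi_holds`) and (15.21) on `n < P` (`eq15_21_wide`)
  supplied by theorems;
* `eq15_22_chi_of_rankin_lemma151` — the typed instance (`V = frake`): `Inline15_Rankin c′ bChi →
  Skeleton.Lemma151ChiR c′ → [smooth majorant] → Eq15_22 c′ inputs15ABchi`.

WHAT THIS IS NOT: a proof of the Rankin cut, of Lemma 15.1 or of the smooth majorant (the three
remaining inputs of the leaf), nor any claim about Theorems 1–2 of the manuscript.

## References
* Y. Zhang, arXiv:2211.02515v1 (2022), §15 pp. 85–87, (15.19)–(15.22), Lemma 15.1.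
  [cite: Zhang2022LandauSiegel, §15 (15.22) p.87]
-/

noncomputable section

open Complex Real ComplexConjugate Finset
open Literature.NumberTheory.LFunctions.Zhang2022.Skeleton
open Literature.NumberTheory.LFunctions.Zhang2022.Typed

namespace Literature.NumberTheory.LFunctions.Zhang2022.Typed.Section15C

/-- `d(mn) ≤ d(m)d(n)`. [folklore] -/
private theorem card_divisors_mul_le' (m n : ℕ) :
    (m * n).divisors.card ≤ m.divisors.card * n.divisors.card := by
  rw [Nat.divisors_mul]
  exact Finset.card_mul_le

/-- The (15.21) error inside one inner sum (pointwise bookkeeping): with `|b(m)| ≤ C_b τ₂(m)`,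
`‖ϖ(n) − ρ(n)‖ ≤ C₁τ₂(n)E` on `R ⊆ [1, N)` and `Σ_{n<N} τ₂(n)²/n ≤ B`,
`‖Σ_{n∈R} b_χ(n₁n)(ϖ(n) − ρ(n))/n‖ ≤ |C_b||C₁|·E·B·τ₂(n₁)` (`τ₂(n₁n) ≤ τ₂(n₁)τ₂(n)`).
[cite: Zhang2022LandauSiegel, §15 (15.21) p.86] -/
private theorem norm_sum_bChi_mul_sub_le' {D : ℕ} (χ : DirichletCharacter ℂ D) (ϖ ρ : ℕ → ℂ)
    {Cb C₁ E B : ℝ} {R : Finset ℕ} {N : ℕ} (hR : R ⊆ Finset.Ico 1 N)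
    (hb : ∀ m : ℕ, ‖bcoef D m‖ ≤ Cb * (m.divisors.card : ℝ)) (hE : 0 ≤ E)
    (h21 : ∀ n ∈ R, ‖ϖ n - ρ n‖ ≤ C₁ * (n.divisors.card : ℝ) * E)
    (hτ : ∑ n ∈ Finset.Ico 1 N, (n.divisors.card : ℝ) ^ 2 / n ≤ B) (n₁ : ℕ) :
    ‖∑ n ∈ R, Section15A.bChi D χ (n₁ * n) * (ϖ n - ρ n) / (n : ℂ)‖ ≤
      |Cb| * |C₁| * E * B * n₁.divisors.card := by
  have hterm : ∀ n ∈ R, ‖Section15A.bChi D χ (n₁ * n) * (ϖ n - ρ n) / (n : ℂ)‖ ≤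
      |Cb| * |C₁| * E * n₁.divisors.card * ((n.divisors.card : ℝ) ^ 2 / n) := by
    intro n hn
    have hn1 : 1 ≤ n := (Finset.mem_Ico.mp (hR hn)).1
    have hn0 : (0 : ℝ) < n := by exact_mod_cast hn1
    have hbn : ‖Section15A.bChi D χ (n₁ * n)‖ ≤ |Cb| * (n₁.divisors.card * n.divisors.card) := by
      have h1 : ‖bcoef D (n₁ * n)‖ ≤ Cb * ((n₁ * n).divisors.card : ℝ) := hb _
      have h2 : ((n₁ * n).divisors.card : ℝ) ≤ n₁.divisors.card * n.divisors.card := by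
        exact_mod_cast card_divisors_mul_le' n₁ n
      have eb : Section15A.bChi D χ (n₁ * n) = χ ((n₁ * n : ℕ) : ZMod D) * bcoef D (n₁ * n) := rfl
      calc ‖Section15A.bChi D χ (n₁ * n)‖
          = ‖χ ((n₁ * n : ℕ) : ZMod D)‖ * ‖bcoef D (n₁ * n)‖ := by rw [eb, norm_mul]
        _ ≤ 1 * (Cb * ((n₁ * n).divisors.card : ℝ)) :=
            mul_le_mul (DirichletCharacter.norm_le_one χ _) h1 (norm_nonneg _) zero_le_one
        _ ≤ |Cb| * ((n₁ * n).divisors.card : ℝ) := by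
            rw [one_mul]
            exact mul_le_mul_of_nonneg_right (le_abs_self _) (Nat.cast_nonneg _)
        _ ≤ |Cb| * (n₁.divisors.card * n.divisors.card) :=
            mul_le_mul_of_nonneg_left h2 (abs_nonneg _)
    have hv : ‖ϖ n - ρ n‖ ≤ |C₁| * (n.divisors.card : ℝ) * E := by
      refine (h21 n hn).trans ?_
      gcongr
      exact le_abs_self _
    rw [norm_div, norm_mul, Complex.norm_natCast, div_le_iff₀ hn0]
    calc ‖Section15A.bChi D χ (n₁ * n)‖ * ‖ϖ n - ρ n‖
        ≤ (|Cb| * (n₁.divisors.card * n.divisors.card)) * (|C₁| * (n.divisors.card : ℝ) * E) :=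
          mul_le_mul hbn hv (norm_nonneg _) (by positivity)
      _ = |Cb| * |C₁| * E * n₁.divisors.card * ((n.divisors.card : ℝ) ^ 2 / n) * n := by
          field_simp
  calc ‖∑ n ∈ R, Section15A.bChi D χ (n₁ * n) * (ϖ n - ρ n) / (n : ℂ)‖
      ≤ ∑ n ∈ R, ‖Section15A.bChi D χ (n₁ * n) * (ϖ n - ρ n) / (n : ℂ)‖ := norm_sum_le _ _
    _ ≤ ∑ n ∈ R, |Cb| * |C₁| * E * n₁.divisors.card * ((n.divisors.card : ℝ) ^ 2 / n) :=
        Finset.sum_le_sum hterm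
    _ = |Cb| * |C₁| * E * n₁.divisors.card * ∑ n ∈ R, (n.divisors.card : ℝ) ^ 2 / n := by
        rw [Finset.mul_sum]
    _ ≤ |Cb| * |C₁| * E * n₁.divisors.card * ∑ n ∈ Finset.Ico 1 N, (n.divisors.card : ℝ) ^ 2 / n := by
        refine mul_le_mul_of_nonneg_left ?_ (by positivity)
        exact Finset.sum_le_sum_of_subset_of_nonneg hR fun n _ _ => by positivity
    _ ≤ |Cb| * |C₁| * E * n₁.divisors.card * B := mul_le_mul_of_nonneg_left hτ (by positivity)
    _ = |Cb| * |C₁| * E * B * n₁.divisors.card := by ring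

open scoped Classical in
/-- **(15.22) GENERIC IN THE VALUE** (RT-05 / R-28 shape): (15.19)@bChi + (15.20)@bChi + Rankin + (15.21)
(range `n < P`) + Lemma 15.1 in the `χ`-reading at an ARBITRARY value family `V j` (rate `α₁`) + the smooth
majorant `Σ_{n₁∈𝒩(𝒬),n₁<T} τ₂|ϖ₁ⱼ|/n₁ ≪ 𝓛⁶` ⇒ `𝒮₁ⱼ = V j·𝓜₁(1,1;1−βⱼ)·Σ_{n∈𝒩(𝒬),n<T}χτ₂ϖ₁ⱼ/n + O(1/𝓛)`
(at `V = frake` this is the typed (15.22) at `inputs15ABchi`; at the e″-derived value it is the RT-05 twin). The chain is the printed one: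
`𝒮₁ⱼ = 𝓜₁(1,1;1−βⱼ)Σₙ b(n)ϖ₁ⱼ(n)/n` (15.19) `= 𝓜₁Σ_{n₁∈𝒩(𝒬)}ϖ₁ⱼ(n₁)/n₁ Σ_{(n,𝒬)=1}b(n₁n)ϖ₁ⱼ(n)/n`
(15.20), the cut `n₁ < T` at cost `O(ε₁)` (Rankin), then on the rough variable `ϖ₁ⱼ(n) = χ(n)ϱ*ⱼ(n) +
O(τ₂(n)D^{−c})` (15.21) and Lemma 15.1 gives `Σ_{(n,𝒬)=1} b(n₁n)χ(n)ϱ*ⱼ(n)/n = χ(n₁)τ₂(n₁)𝔢ⱼ + O(α₁τ₂(n₁))`;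
the error terms sum to `O(𝓜₁·(ε₁ + (α₁ + D^{−c}𝓛³⁶)·Σ_{n₁}τ₂|ϖ₁ⱼ|/n₁)) = O(1/𝓛)`.
[cite: Zhang2022LandauSiegel, §15 (15.22) p.87] -/
theorem calS1_eval_of_parts_value (c' : ℝ) (V : ℕ → ℂ)
    (h19 : Section15B.Eq15_19 c' Section15A.bChi) (h20 : Section15B.Eq15_20 c' Section15A.bChi)
    (h21 : ∃ c : ℝ, 0 < c ∧ ∃ C : ℝ, ForAllLarge fun D _ χ => AssumptionA D χ →
      ∀ j ∈ ({1, 2, 3} : Finset ℕ), ∀ n : ℕ, 1 ≤ n → (n : ℝ) < bigP D → Nat.Coprime n (frakq D) →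
        ‖Section15B.varpi1 c' χ j n - χ (n : ZMod D) * varrhoStar c' χ j n‖ ≤
          C * (n.divisors.card : ℝ) * (D : ℝ) ^ (-c))
    (hR : Section15B.Inline15_Rankin c' Section15A.bChi)
    (h151 : ∃ C : ℝ, ForAllLarge fun D _ χ => AssumptionA D χ → ∀ j ∈ ({1, 2, 3} : Finset ℕ),
      ∀ n₁ : ℕ, n₁ ∈ nset (frakq D) → (n₁ : ℝ) < bigT D →
        ‖(∑ n ∈ (Finset.Ico 1 ⌈bigP D⌉₊).filter (fun n => Nat.Coprime n (frakq D)),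
            χ ((n₁ * n : ℕ) : ZMod D) * bcoef D (n₁ * n) * χ (n : ZMod D) *
              varrhoStar c' χ j n / (n : ℂ)) -
          χ (n₁ : ZMod D) * (n₁.divisors.card : ℂ) * V j‖ ≤ C * alpha1 D * n₁.divisors.card)
    (hS : ∃ C : ℝ, ForAllLarge fun D _ χ => AssumptionA D χ → ∀ j ∈ ({1, 2, 3} : Finset ℕ),
      ∑ n ∈ (Finset.Ico 1 ⌈bigT D⌉₊).filter (fun n => n ∈ nset (frakq D)),
        (n.divisors.card : ℝ) * ‖Section15B.varpi1 c' χ j n‖ / n ≤ C * ell D ^ 6) :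
    ∃ C : ℝ, ForAllLarge fun D _ χ => AssumptionA D χ → ∀ j ∈ ({1, 2, 3} : Finset ℕ),
      ‖Section15B.calS1 c' χ (Section15A.bChi D χ) j -
          V j * Section15B.calM1 c' χ 1 1 (1 - betaJ c' D j) * sumInN c' inputs15ABchi χ j‖ ≤
        C / ell D := by
  obtain ⟨c₁, hc₁, C₁, h21F⟩ := h21
  obtain ⟨c₂, hc₂, C₂, hRF⟩ := hR
  obtain ⟨C₃, h151F⟩ := h151
  obtain ⟨C₄, hSF⟩ := hS
  obtain ⟨Cb, hbF⟩ := Section15A.eq15_2_holds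
  obtain ⟨c₅, C₅, h35F⟩ := Section15B.step15_u035_holds c'
  have h19F := h19
  have h20F := h20
  -- the constant of the `D^{-c}` term and the eventual numerics
  set K : ℝ := |Cb| * |C₁| * 16 with hK
  obtain ⟨D₆, hD₆⟩ := eps1_le_inv_ell hc₂ (|C₅| * |C₂|)
  obtain ⟨D₇, hD₇⟩ := rpow_neg_mul_ell_pow_le_inv_ell hc₁ (|C₅| * |C₄| * K) 42
  obtain ⟨D₈, hD₈⟩ := exists_nat_forall_le_ell 1
  obtain ⟨D₀, hall⟩ :=
    ((((((h21F.and hRF).and h151F).and hSF).and hbF).and h35F).and h19F).and h20F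
  refine ⟨2 + |C₅| * |C₄| * |C₃| * Real.pi, max (max D₀ D₆) (max D₇ D₈),
    fun D _ χ hD hq hp hA j hj => ?_⟩
  have hD₀ : D₀ ≤ D := le_trans (le_trans (le_max_left _ _) (le_max_left _ _)) hD
  have hD6 : D₆ ≤ D := le_trans (le_trans (le_max_right _ _) (le_max_left _ _)) hD
  have hD7 : D₇ ≤ D := le_trans (le_trans (le_max_left _ _) (le_max_right _ _)) hD
  have hD8 : D₈ ≤ D := le_trans (le_trans (le_max_right _ _) (le_max_right _ _)) hD
  obtain ⟨⟨⟨⟨⟨⟨⟨h21D, hRD⟩, h151D⟩, hSD⟩, hbD⟩, h35D⟩, h19D⟩, h20D⟩ := hall D χ hD₀ hq hp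
  have hℓ1 : 1 ≤ ell D := hD₈ D hD8
  have hℓ0 : 0 < ell D := by linarith
  have e6 := hD₆ D hD6
  have e7 := hD₇ D hD7
  -- names
  set ϖ : ℕ → ℂ := Section15B.varpi1 c' χ j with hϖ
  set M : ℂ := Section15B.calM1 c' χ 1 1 (1 - betaJ c' D j) with hM
  set NP : ℕ := ⌈bigP D⌉₊ with hNP
  set NT : ℕ := ⌈bigT D⌉₊ with hNT
  set Q : ℕ := frakq D with hQ
  set R : Finset ℕ := (Finset.Ico 1 NP).filter (fun n => Nat.Coprime n Q) with hRset
  set ST : Finset ℕ := (Finset.Ico 1 NT).filter (fun n => n ∈ nset Q) with hST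
  set inner : ℕ → ℂ := fun n₁ => ∑ n ∈ R, Section15A.bChi D χ (n₁ * n) * ϖ n / (n : ℂ) with hinner
  set A : ℂ := ∑ n₁ ∈ (Finset.Ico 1 NP).filter (fun n₁ => n₁ ∈ nset Q),
    ϖ n₁ / (n₁ : ℂ) * inner n₁ with hAdef
  set AT : ℂ := ∑ n₁ ∈ (Finset.Ico 1 NP).filter (fun n₁ => n₁ ∈ nset Q ∧ (n₁ : ℝ) < bigT D),
    ϖ n₁ / (n₁ : ℂ) * inner n₁ with hAT
  -- (15.19), (15.20), Rankin
  have e19 : Section15B.calS1 c' χ (Section15A.bChi D χ) j =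
      M * ∑ n ∈ Finset.Ico 1 NP, Section15A.bChi D χ n * ϖ n / (n : ℂ) := h19D hA j hj
  have e20 : ∑ n ∈ Finset.Ico 1 NP, Section15A.bChi D χ n * ϖ n / (n : ℂ) = A := h20D hA j hj
  have eR : ‖A - AT‖ ≤ C₂ * Real.exp (-c₂ * ell D ^ (1 / 10 : ℝ)) := hRD hA j hj
  -- `T ≤ P`, so the Rankin-cut set is `ST`
  have hTP : bigT D ≤ bigP D := by
    rw [bigT, bigP]
    refine Real.exp_le_exp.mpr ?_
    calc ell D ^ (1.1 : ℝ) ≤ ell D ^ (9 : ℝ) := Real.rpow_le_rpow_of_exponent_le hℓ1 (by norm_num)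
      _ = ell D ^ 9 := by norm_num
  have hSTeq : (Finset.Ico 1 NP).filter (fun n₁ => n₁ ∈ nset Q ∧ (n₁ : ℝ) < bigT D) = ST := by
    ext n
    simp only [hST, Finset.mem_filter, Finset.mem_Ico, hNT, hNP, Nat.lt_ceil]
    constructor
    · rintro ⟨⟨h1, -⟩, hn, hT⟩; exact ⟨⟨h1, hT⟩, hn⟩
    · rintro ⟨⟨h1, hT⟩, hn⟩; exact ⟨⟨h1, lt_of_lt_of_le hT hTP⟩, hn, hT⟩
  have eAT : AT = ∑ n₁ ∈ ST, ϖ n₁ / (n₁ : ℂ) * inner n₁ := by rw [hAT, hSTeq]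
  -- the target, unfolded
  have eSum : sumInN c' inputs15ABchi χ j =
      ∑ n ∈ ST, χ (n : ZMod D) * (n.divisors.card : ℂ) * ϖ n / (n : ℂ) := by
    rw [sumInN]; rfl
  rw [eSum, e19, e20]
  -- `‖M‖ ≤ C₅`
  have hMle : ‖M‖ ≤ |C₅| := by
    have hre : 9 / 10 < (1 - betaJ c' D j).re := by
      simp only [Complex.sub_re, Complex.one_re, Section15B.betaJ_re]; norm_num
    have h := h35D hA 1 1 le_rfl le_rfl _ hre
    rw [mul_one, Nat.primeFactors_one, Finset.prod_empty, mul_one] at h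
    exact h.trans (le_abs_self _)
  -- the error of one inner sum, `n₁ ∈ ST`
  have hlogNP : (1 + Real.log ((NP - 1 : ℕ) : ℝ)) ^ 4 ≤ 16 * ell D ^ 36 := by
    have hP1 : ((NP - 1 : ℕ) : ℝ) ≤ bigP D := by
      have hP0 : 0 ≤ bigP D := (Real.exp_pos _).le
      have h := Nat.ceil_lt_add_one hP0
      rcases Nat.eq_zero_or_pos NP with h0 | h0
      · rw [h0]; simpa using hP0
      · rw [Nat.cast_sub h0, Nat.cast_one, hNP]; linarith
    have hlog : Real.log ((NP - 1 : ℕ) : ℝ) ≤ ell D ^ 9 := by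
      rcases Nat.eq_zero_or_pos (NP - 1) with h0 | h0
      · rw [h0, Nat.cast_zero, Real.log_zero]; positivity
      · calc Real.log ((NP - 1 : ℕ) : ℝ) ≤ Real.log (bigP D) :=
              Real.log_le_log (by exact_mod_cast h0) hP1
          _ = ell D ^ 9 := by rw [bigP, Real.log_exp]
    have h9 : (1 : ℝ) ≤ ell D ^ 9 := one_le_pow₀ hℓ1
    have hlog0 := Real.log_natCast_nonneg (NP - 1)
    calc (1 + Real.log ((NP - 1 : ℕ) : ℝ)) ^ 4 ≤ (ell D ^ 9 + ell D ^ 9) ^ 4 :=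
          pow_le_pow_left₀ (by linarith) (by linarith) 4
      _ = 16 * ell D ^ 36 := by ring
  have hτsum : ∑ n ∈ Finset.Ico 1 NP, ((n.divisors.card : ℝ)) ^ 2 / n ≤ 16 * ell D ^ 36 := by
    have hIco : Finset.Ico 1 NP = Finset.Icc 1 (NP - 1) := by
      ext n; simp only [Finset.mem_Ico, Finset.mem_Icc]; omega
    rw [hIco]
    exact (sum_card_divisors_pow_div_le_log_pow 2 (NP - 1)).trans hlogNP
  have hDc : 0 ≤ (D : ℝ) ^ (-c₁) := Real.rpow_nonneg (Nat.cast_nonneg D) _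
  have hinner : ∀ n₁ ∈ ST, ‖inner n₁ - χ (n₁ : ZMod D) * (n₁.divisors.card : ℂ) * V j‖ ≤
      (|C₃| * alpha1 D + K * (D : ℝ) ^ (-c₁) * ell D ^ 36) * n₁.divisors.card := by
    intro n₁ hn₁
    have hn₁' := Finset.mem_filter.mp hn₁
    have hn₁Q : n₁ ∈ nset Q := hn₁'.2
    have hn₁T : (n₁ : ℝ) < bigT D := by
      have := (Finset.mem_Ico.mp hn₁'.1).2; rw [hNT] at this; exact Nat.lt_ceil.mp this
    -- split the inner sum along `ϖ = χϱ* + (ϖ − χϱ*)`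
    have hsplit : inner n₁ =
        (∑ n ∈ R, χ ((n₁ * n : ℕ) : ZMod D) * bcoef D (n₁ * n) * χ (n : ZMod D) *
            varrhoStar c' χ j n / (n : ℂ)) +
          ∑ n ∈ R, Section15A.bChi D χ (n₁ * n) * (ϖ n - χ (n : ZMod D) * varrhoStar c' χ j n) /
            (n : ℂ) := by
      rw [hinner, ← Finset.sum_add_distrib]
      refine Finset.sum_congr rfl fun n _ => ?_
      have eb : Section15A.bChi D χ (n₁ * n) = χ ((n₁ * n : ℕ) : ZMod D) * bcoef D (n₁ * n) := rfl
      rw [eb]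
      ring
    have h151n := h151D hA j hj n₁ hn₁Q hn₁T
    -- the (15.21) part
    have h21n : ‖∑ n ∈ R, Section15A.bChi D χ (n₁ * n) *
        (ϖ n - χ (n : ZMod D) * varrhoStar c' χ j n) / (n : ℂ)‖ ≤
        K * (D : ℝ) ^ (-c₁) * ell D ^ 36 * n₁.divisors.card := by
      have hb' : ∀ m : ℕ, ‖bcoef D m‖ ≤ Cb * (m.divisors.card : ℝ) := fun m => by
        have h1 := hbD.1 m; rwa [MeanSquareMajorant.tau_two_apply] at h1
      have h21' : ∀ n ∈ R, ‖ϖ n - (fun m : ℕ => χ (m : ZMod D) * varrhoStar c' χ j m) n‖ ≤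
          C₁ * (n.divisors.card : ℝ) * (D : ℝ) ^ (-c₁) := by
        intro n hn
        have hn' := Finset.mem_filter.mp hn
        have hn1 : 1 ≤ n := (Finset.mem_Ico.mp hn'.1).1
        have hnP : (n : ℝ) < bigP D := by
          have := (Finset.mem_Ico.mp hn'.1).2; rw [hNP] at this; exact Nat.lt_ceil.mp this
        exact h21D hA j hj n hn1 hnP hn'.2
      have h := norm_sum_bChi_mul_sub_le' χ ϖ (fun m : ℕ => χ (m : ZMod D) * varrhoStar c' χ j m)
        (Finset.filter_subset _ _) hb' hDc h21' hτsum n₁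
      calc ‖∑ n ∈ R, Section15A.bChi D χ (n₁ * n) *
            (ϖ n - χ (n : ZMod D) * varrhoStar c' χ j n) / (n : ℂ)‖
          ≤ |Cb| * |C₁| * (D : ℝ) ^ (-c₁) * (16 * ell D ^ 36) * n₁.divisors.card := h
        _ = K * (D : ℝ) ^ (-c₁) * ell D ^ 36 * n₁.divisors.card := by rw [hK]; ring
    have h151n' : ‖(∑ n ∈ R, χ ((n₁ * n : ℕ) : ZMod D) * bcoef D (n₁ * n) * χ (n : ZMod D) *
        varrhoStar c' χ j n / (n : ℂ)) - χ (n₁ : ZMod D) * (n₁.divisors.card : ℂ) * V j‖ ≤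
        |C₃| * alpha1 D * n₁.divisors.card := by
      refine h151n.trans ?_
      have hα1 : 0 ≤ alpha1 D := by
        rw [alpha1, log_bigT]
        exact mul_nonneg (alpha_nonneg D) (Real.rpow_nonneg hℓ0.le _)
      gcongr
      exact le_abs_self _
    rw [hsplit]
    calc ‖(∑ n ∈ R, χ ((n₁ * n : ℕ) : ZMod D) * bcoef D (n₁ * n) * χ (n : ZMod D) *
            varrhoStar c' χ j n / (n : ℂ)) +
          (∑ n ∈ R, Section15A.bChi D χ (n₁ * n) * (ϖ n - χ (n : ZMod D) * varrhoStar c' χ j n) /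
            (n : ℂ)) - χ (n₁ : ZMod D) * (n₁.divisors.card : ℂ) * V j‖
        = ‖((∑ n ∈ R, χ ((n₁ * n : ℕ) : ZMod D) * bcoef D (n₁ * n) * χ (n : ZMod D) *
            varrhoStar c' χ j n / (n : ℂ)) - χ (n₁ : ZMod D) * (n₁.divisors.card : ℂ) * V j) +
          ∑ n ∈ R, Section15A.bChi D χ (n₁ * n) * (ϖ n - χ (n : ZMod D) * varrhoStar c' χ j n) /
            (n : ℂ)‖ := by
          congr 1; ring
      _ ≤ |C₃| * alpha1 D * n₁.divisors.card + K * (D : ℝ) ^ (-c₁) * ell D ^ 36 * n₁.divisors.card :=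
          (norm_add_le _ _).trans (add_le_add h151n' h21n)
      _ = (|C₃| * alpha1 D + K * (D : ℝ) ^ (-c₁) * ell D ^ 36) * n₁.divisors.card := by ring
  -- the main difference as a sum over `ST`
  have hdiff : AT - V j * ∑ n ∈ ST, χ (n : ZMod D) * (n.divisors.card : ℂ) * ϖ n / (n : ℂ) =
      ∑ n₁ ∈ ST, ϖ n₁ / (n₁ : ℂ) *
        (inner n₁ - χ (n₁ : ZMod D) * (n₁.divisors.card : ℂ) * V j) := by
    rw [eAT, Finset.mul_sum, ← Finset.sum_sub_distrib]
    refine Finset.sum_congr rfl fun n₁ _ => ?_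
    ring
  -- sizes
  have hα1 : 0 ≤ alpha1 D := by
    rw [alpha1, log_bigT]; exact mul_nonneg (alpha_nonneg D) (Real.rpow_nonneg hℓ0.le _)
  set L : ℝ := |C₃| * alpha1 D + K * (D : ℝ) ^ (-c₁) * ell D ^ 36 with hL
  have hL0 : 0 ≤ L := by rw [hL, hK]; positivity
  have hSle : ∑ n ∈ ST, (n.divisors.card : ℝ) * ‖ϖ n‖ / n ≤ |C₄| * ell D ^ 6 := by
    refine (hSD hA j hj).trans ?_
    gcongr; exact le_abs_self _
  have hsum : ‖∑ n₁ ∈ ST, ϖ n₁ / (n₁ : ℂ) *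
      (inner n₁ - χ (n₁ : ZMod D) * (n₁.divisors.card : ℂ) * V j)‖ ≤ L * (|C₄| * ell D ^ 6) := by
    calc ‖∑ n₁ ∈ ST, ϖ n₁ / (n₁ : ℂ) *
          (inner n₁ - χ (n₁ : ZMod D) * (n₁.divisors.card : ℂ) * V j)‖
        ≤ ∑ n₁ ∈ ST, ‖ϖ n₁ / (n₁ : ℂ) *
          (inner n₁ - χ (n₁ : ZMod D) * (n₁.divisors.card : ℂ) * V j)‖ := norm_sum_le _ _
      _ ≤ ∑ n₁ ∈ ST, L * ((n₁.divisors.card : ℝ) * ‖ϖ n₁‖ / n₁) := by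
          refine Finset.sum_le_sum fun n₁ hn₁ => ?_
          rw [norm_mul, norm_div, Complex.norm_natCast]
          calc ‖ϖ n₁‖ / (n₁ : ℝ) * ‖inner n₁ - χ (n₁ : ZMod D) * (n₁.divisors.card : ℂ) * V j‖
              ≤ ‖ϖ n₁‖ / (n₁ : ℝ) * (L * n₁.divisors.card) :=
                mul_le_mul_of_nonneg_left (hinner n₁ hn₁) (by positivity)
            _ = L * ((n₁.divisors.card : ℝ) * ‖ϖ n₁‖ / n₁) := by ring
      _ = L * ∑ n₁ ∈ ST, (n₁.divisors.card : ℝ) * ‖ϖ n₁‖ / n₁ := by rw [Finset.mul_sum]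
      _ ≤ L * (|C₄| * ell D ^ 6) := mul_le_mul_of_nonneg_left hSle hL0
  -- the three eventual sizes
  have s1 : |C₅| * (C₂ * Real.exp (-c₂ * ell D ^ (1 / 10 : ℝ))) ≤ 1 / ell D := by
    calc |C₅| * (C₂ * Real.exp (-c₂ * ell D ^ (1 / 10 : ℝ)))
        ≤ |C₅| * (|C₂| * Real.exp (-c₂ * ell D ^ (1 / 10 : ℝ))) := by
          gcongr; exact le_abs_self _
      _ = |C₅| * |C₂| * Real.exp (-c₂ * ell D ^ (1 / 10 : ℝ)) := by ring
      _ ≤ 1 / ell D := e6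
  have s2 : |C₅| * (|C₃| * alpha1 D) * (|C₄| * ell D ^ 6) ≤ |C₅| * |C₄| * |C₃| * Real.pi / ell D := by
    have h := alpha1_mul_ell_pow_six_le hℓ1
    calc |C₅| * (|C₃| * alpha1 D) * (|C₄| * ell D ^ 6)
        = |C₅| * |C₄| * |C₃| * (alpha1 D * ell D ^ 6) := by ring
      _ ≤ |C₅| * |C₄| * |C₃| * (Real.pi / ell D) := by gcongr
      _ = |C₅| * |C₄| * |C₃| * Real.pi / ell D := by ring
  have s3 : |C₅| * (K * (D : ℝ) ^ (-c₁) * ell D ^ 36) * (|C₄| * ell D ^ 6) ≤ 1 / ell D := by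
    calc |C₅| * (K * (D : ℝ) ^ (-c₁) * ell D ^ 36) * (|C₄| * ell D ^ 6)
        = |C₅| * |C₄| * K * (D : ℝ) ^ (-c₁) * ell D ^ 42 := by ring
      _ ≤ 1 / ell D := e7
  -- assemble
  have key : M * A - V j * M * ∑ n ∈ ST, χ (n : ZMod D) * (n.divisors.card : ℂ) * ϖ n / (n : ℂ) =
      M * (A - AT) + M * (AT - V j * ∑ n ∈ ST, χ (n : ZMod D) * (n.divisors.card : ℂ) * ϖ n / (n : ℂ)) := by
    ring
  rw [key, hdiff]
  calc ‖M * (A - AT) + M * ∑ n₁ ∈ ST, ϖ n₁ / (n₁ : ℂ) *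
          (inner n₁ - χ (n₁ : ZMod D) * (n₁.divisors.card : ℂ) * V j)‖
      ≤ ‖M‖ * ‖A - AT‖ + ‖M‖ * ‖∑ n₁ ∈ ST, ϖ n₁ / (n₁ : ℂ) *
          (inner n₁ - χ (n₁ : ZMod D) * (n₁.divisors.card : ℂ) * V j)‖ := by
        refine (norm_add_le _ _).trans ?_
        rw [norm_mul, norm_mul]
    _ ≤ |C₅| * (C₂ * Real.exp (-c₂ * ell D ^ (1 / 10 : ℝ))) + |C₅| * (L * (|C₄| * ell D ^ 6)) := by
        gcongr
    _ = |C₅| * (C₂ * Real.exp (-c₂ * ell D ^ (1 / 10 : ℝ))) +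
          (|C₅| * (|C₃| * alpha1 D) * (|C₄| * ell D ^ 6) +
            |C₅| * (K * (D : ℝ) ^ (-c₁) * ell D ^ 36) * (|C₄| * ell D ^ 6)) := by rw [hL]; ring
    _ ≤ 1 / ell D + (|C₅| * |C₄| * |C₃| * Real.pi / ell D + 1 / ell D) :=
        add_le_add s1 (add_le_add s2 s3)
    _ = (2 + |C₅| * |C₄| * |C₃| * Real.pi) / ell D := by ring


open scoped Classical in
/-- **(15.22) generic in the value, Sketch shape `calS1_eval_of_parts`** (WP15-PLAN v0.2 §3.3): the value
family `(E1 j + ι₂e₂ⱼ)(ῑ₃e₃ⱼ + ῑ₄e₂ⱼ)` for an arbitrary `E1 : ℕ → ℂ` (`E1 = e1j` gives `frake j`, by `rfl`);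
(15.19), (15.20), (15.21) on `n < P` are supplied by theorems (`Typed.Section15B.eq15_19_chi_holds`,
`eq15_20_chi_holds`, `eq15_21_wide`). Remaining inputs: Rankin, Lemma 15.1 at the value `E1`, the smooth
majorant. [cite: Zhang2022LandauSiegel, §15 (15.22) p.87] -/
theorem calS1_eval_of_parts (c' : ℝ) (E1 : ℕ → ℂ)
    (hR : Section15B.Inline15_Rankin c' Section15A.bChi)
    (h151 : ∃ C : ℝ, ForAllLarge fun D _ χ => AssumptionA D χ → ∀ j ∈ ({1, 2, 3} : Finset ℕ),
      ∀ n₁ : ℕ, n₁ ∈ nset (frakq D) → (n₁ : ℝ) < bigT D →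
        ‖(∑ n ∈ (Finset.Ico 1 ⌈bigP D⌉₊).filter (fun n => Nat.Coprime n (frakq D)),
            χ ((n₁ * n : ℕ) : ZMod D) * bcoef D (n₁ * n) * χ (n : ZMod D) *
              varrhoStar c' χ j n / (n : ℂ)) -
          χ (n₁ : ZMod D) * (n₁.divisors.card : ℂ) *
            ((E1 j + iota2 * e2j j) * (conj iota3 * e3j j + conj iota4 * e2j j))‖ ≤
        C * alpha1 D * n₁.divisors.card)
    (hS : ∃ C : ℝ, ForAllLarge fun D _ χ => AssumptionA D χ → ∀ j ∈ ({1, 2, 3} : Finset ℕ),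
      ∑ n ∈ (Finset.Ico 1 ⌈bigT D⌉₊).filter (fun n => n ∈ nset (frakq D)),
        (n.divisors.card : ℝ) * ‖Section15B.varpi1 c' χ j n‖ / n ≤ C * ell D ^ 6) :
    ∃ C : ℝ, ForAllLarge fun D _ χ => AssumptionA D χ → ∀ j ∈ ({1, 2, 3} : Finset ℕ),
      ‖Section15B.calS1 c' χ (Section15A.bChi D χ) j -
          (E1 j + iota2 * e2j j) * (conj iota3 * e3j j + conj iota4 * e2j j) *
            Section15B.calM1 c' χ 1 1 (1 - betaJ c' D j) *
              sumInN c' inputs15ABchi χ j‖ ≤ C / ell D :=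
  calS1_eval_of_parts_value c'
    (fun j => (E1 j + iota2 * e2j j) * (conj iota3 * e3j j + conj iota4 * e2j j))
    (Section15B.eq15_19_chi_holds c') (Section15B.eq15_20_chi_holds c') (Section15B.eq15_21_wide c') hR
    h151 hS

open scoped Classical in
/-- **Leaf `h15_22` (AS TYPED, value `frake j`) reduced to three inputs**: the Rankin cut
`Inline15_Rankin c′ bChi`, Lemma 15.1 in the χ-reading of record `Skeleton.Lemma151ChiR c′`, and the smooth
majorant `Σ_{n₁∈𝒩(𝒬), n₁<T} τ₂(n₁)|ϖ₁ⱼ(n₁)|/n₁ ≤ C𝓛⁶` give `Eq15_22 c′ inputs15ABchi`; (15.19), (15.20),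
(15.21) (on `n < P`) are theorems. (Per WP15-PLAN §2.1 the typed `Lemma151ChiR` carries the STATED e″ and is
not a discharge target; this corollary records the shape, the E-generic `calS1_eval_of_parts` is the one to
instantiate at the derived value.) [cite: Zhang2022LandauSiegel, §15 (15.22) p.87] -/
theorem eq15_22_chi_of_rankin_lemma151 (c' : ℝ)
    (hR : Section15B.Inline15_Rankin c' Section15A.bChi)
    (h151 : Lemma151ChiR c')
    (hS : ∃ C : ℝ, ForAllLarge fun D _ χ => AssumptionA D χ → ∀ j ∈ ({1, 2, 3} : Finset ℕ),
      ∑ n ∈ (Finset.Ico 1 ⌈bigT D⌉₊).filter (fun n => n ∈ nset (frakq D)),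
        (n.divisors.card : ℝ) * ‖Section15B.varpi1 c' χ j n‖ / n ≤ C * ell D ^ 6) :
    Eq15_22 c' inputs15ABchi :=
  calS1_eval_of_parts_value c' frake (Section15B.eq15_19_chi_holds c')
    (Section15B.eq15_20_chi_holds c') (Section15B.eq15_21_wide c') hR h151 hS

end Literature.NumberTheory.LFunctions.Zhang2022.Typed.Section15C
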